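import Summits.ABC.IUTFork.Conditional.FreyLegendreP6Engine
import HarnessLib

/-!
# (P6) ENGINE, LIST FORM: `∀ l ∈ L, Cor22.CondP6 (ratPoint (a/c)) l` from ONE Frobenius certificate, with ALL side conditions
# and the rootlessness of `X² − a_pX + p` mod every `l ∈ L` decided in the KERNEL over `ℕ`

PROOF-ONLY file (D-0012; 0 definitions, 0 `Prop` facts, no instance, no notation) of the abc-iut cell (seat abc-iut-w6-d102, gen 5;
row «C:P6-KERNEL-N3», continuation of C-R66 (b) / C-R69 (2)). The datum-parametric engine `FreyP6Engine.condP6_ratPoint_of_certificate`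
(p477940) discharges (P6) at ONE `(ratPoint (a/c), l)` from a Frobenius certificate `(p, a_p)` whose rootlessness hypothesis
`∀ t : ZMod l, t² − a_p t + p ≠ 0` is a `decide` PER `l`. The R-W table (plan/rescue/R-W/WINDOW-TABLE.tsv v4.25) carries ≈ 72 primes
`l ∈ [13, 397]` per Frey triple of the N3 universe, all marked «P6: Serre-witnessed (desk; kernel: not certified)». This file removes the
per-`l` cost:

* `noroot_zmod_of_nat` — the `ZMod l` rootlessness follows from the `ℕ`-form `∀ t < l, ¬ (l : ℤ) ∣ t² − a_p·t + p`, and a LIST of such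
  `ℕ`-forms `∀ l ∈ L, ∀ t < l, …` is ONE closed decidable proposition (`decide +kernel`, GMP arithmetic; farm: < 3 s for 72 primes ≤ 397);
* `condP6_ratPoint_of_certificate_list` — for the Frey–Legendre model `E₁ = [0, −(c²+ac), 0, ac³, 0]` of `y² = x(x−1)(x−a/c)`, ONE
  multiplicative prime (`q ∤ c₄(E₁)`, `Δ(E₁) = q^k·D`, `q ∤ D`, `0 < k`) and ONE good prime `p` with `a_p(E₁) = ap` give
  `∀ l ∈ L, Cor22.CondP6 (ratPoint (a/c)) l` as soon as `∀ l ∈ L, l.Prime ∧ l ∤ 46080 ∧ q ∤ l ∧ l ∤ k ∧ p ≠ l` (ONE `decide +kernel`: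
  the kernel decides `Nat.Prime` at these sizes) and the `ℕ`-rootlessness list hold. A datum with several certificate primes is the
  `List.append` of the per-prime conclusions.

HONEST SCOPE: classical, undisputed arithmetic of elliptic curves over `ℚ` (Serre 1972 / Mazur 1978 / a Tate transvection), exactly the
content of p477940 re-packaged; nothing here is about Θ-data or [IUTchIII] Cor. 3.12; no side taken on any author; typed ≠ proved for every
IUT sentence; no abc claim.
[cite: Mochizuki2012, IUTchIV Cor. 2.2 (ii) proof (P6) p. 46; IUTchI Def. 3.1 (c) p. 62] [cite: Mazur1978, §6 Prop. 6.3 (1) p. 153]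
[cite: MochizukiGenEll2010, Lem. 3.1 (iii) p. 14] [claim: Mochizuki2012, status: disputed] for every IUT quotation.
-/

noncomputable section

open scoped Classical
open WeierstrassCurve

namespace Summit.ABC.IUTFork.Conditional

namespace FreyP6Engine

open Literature.NumberTheory.EllipticCurves Literature.NumberTheory.DiophantineGeometry.GenEll
open Literature.NumberTheory.DiophantineGeometry Literature.IUT.LogVolume

/-- **`ℕ`-form of rootlessness ⇒ `ZMod l`-form.** If no `t < l` has `l ∣ t² − a·t + p` (in `ℤ`), then `X² − aX + p` has no root in
`ZMod l` (`l ≠ 0`): every `t : ZMod l` is the cast of `t.val < l`, and an integer is `0` in `ZMod l` iff `l` divides it. [folklore] -/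
theorem noroot_zmod_of_nat (l : ℕ) (hl : l ≠ 0) (a : ℤ) (p : ℕ)
    (h : ∀ t < l, ¬ ((l : ℤ) ∣ (t : ℤ) ^ 2 - a * t + p)) :
    ∀ t : ZMod l, t ^ 2 - (a : ZMod l) * t + (p : ZMod l) ≠ 0 := by
  haveI : NeZero l := ⟨hl⟩
  intro t ht
  apply h t.val (ZMod.val_lt t)
  rw [← ZMod.intCast_zmod_eq_zero_iff_dvd]
  push_cast
  rw [ZMod.natCast_zmod_val]
  exact ht

/-- **(P6) ENGINE, LIST FORM.** Let `λ = a/c` (`a, c ≠ 0`, `a ≠ c`), `E₁ = [0, −(c²+ac), 0, ac³, 0]`. GIVEN one multiplicative prime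
`q` of `E₁` (`q ∤ c₄(E₁)`, `Δ(E₁) = q^k·D`, `q ∤ D`, `0 < k`), one good prime `p` (`p ∤ Δ(E₁)`) with Frobenius trace `a_p(E₁) = ap`, and
a list `L` of primes with `l ∤ 46080`, `q ∤ l`, `l ∤ k`, `p ≠ l` and `X² − ap·X + p` rootless mod `l` (in `ℕ`-form) for every `l ∈ L`,
THEN `Cor22.CondP6 (ratPoint λ) l` for every `l ∈ L` — the engine `condP6_ratPoint_of_certificate` (Mazur's Frobenius certificate ⇒
`ρ̄_l` irreducible; Tate transvection at `q` ⇒ `⊇ SL₂(𝔽_l)` over `ℚ`; change of model; UP to every theta-field), fed through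
`noroot_zmod_of_nat`. Both list hypotheses are single `decide +kernel` goals at a datum.
[cite: Mochizuki2012, IUTchIV Cor. 2.2 (ii) (P6) p.46] [cite: Mazur1978, §6 Prop. 6.3 (1) (p. 153)] -/
theorem condP6_ratPoint_of_certificate_list (a c : ℕ) (ha : a ≠ 0) (hc : c ≠ 0) (hac : a ≠ c)
    (q : ℕ) (hq : q.Prime)
    (hc4 : ¬ (q : ℤ) ∣ ((⟨0, -(((c : ℕ) : ℤ) ^ 2 + (a : ℕ) * (c : ℕ)), 0, ((a : ℕ) : ℤ) * ((c : ℕ) : ℤ) ^ 3, 0⟩ : WeierstrassCurve ℤ)).c₄)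
    (k : ℕ) (hk0 : 0 < k) (D : ℤ)
    (hΔ : ((⟨0, -(((c : ℕ) : ℤ) ^ 2 + (a : ℕ) * (c : ℕ)), 0, ((a : ℕ) : ℤ) * ((c : ℕ) : ℤ) ^ 3, 0⟩ : WeierstrassCurve ℤ)).Δ = q ^ k * D)
    (hD : ¬ (q : ℤ) ∣ D)
    (p : ℕ) (hp : p.Prime)
    (hpΔ : ¬ (p : ℤ) ∣ ((⟨0, -(((c : ℕ) : ℤ) ^ 2 + (a : ℕ) * (c : ℕ)), 0, ((a : ℕ) : ℤ) * ((c : ℕ) : ℤ) ^ 3, 0⟩ : WeierstrassCurve ℤ)).Δ)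
    (ap : ℤ) (hap : Literature.NumberTheory.Automorphic.frobeniusTrace
        (⟨0, -(((c : ℕ) : ℤ) ^ 2 + (a : ℕ) * (c : ℕ)), 0, ((a : ℕ) : ℤ) * ((c : ℕ) : ℤ) ^ 3, 0⟩ : WeierstrassCurve ℤ) p = ap)
    (L : List ℕ) (hside : ∀ l ∈ L, l.Prime ∧ ¬ l ∣ 46080 ∧ ¬ q ∣ l ∧ ¬ l ∣ k ∧ p ≠ l)
    (hnr : ∀ l ∈ L, ∀ t < l, ¬ ((l : ℤ) ∣ (t : ℤ) ^ 2 - ap * t + p)) :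
    ∀ l ∈ L, Cor22.CondP6 (ratPoint (((a : ℕ) : ℚ) / (c : ℕ))) l := by
  intro l hl
  obtain ⟨hlp, h46080, hql, hlk, hpl⟩ := hside l hl
  haveI : Fact l.Prime := ⟨hlp⟩
  haveI : Fact p.Prime := ⟨hp⟩
  refine condP6_ratPoint_of_certificate a c ha hc hac l h46080 p hpl hpΔ ?_ q hq hql hc4 k hk0 hlk D hΔ hD
  rw [hap]
  exact noroot_zmod_of_nat l hlp.ne_zero ap p (hnr l hl)

/-- **Single-`l` form with explicit (non-instance) primality and the `ℕ`-rootlessness** — the list engine at `L = [l]`; convenient when a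
consumer wants one `(datum, l)` and the certificate data are already named lemmas. [cite: Mochizuki2012, IUTchIV Cor. 2.2 (ii) (P6) p.46] -/
theorem condP6_ratPoint_of_certificate_nat (a c : ℕ) (ha : a ≠ 0) (hc : c ≠ 0) (hac : a ≠ c)
    (q : ℕ) (hq : q.Prime)
    (hc4 : ¬ (q : ℤ) ∣ ((⟨0, -(((c : ℕ) : ℤ) ^ 2 + (a : ℕ) * (c : ℕ)), 0, ((a : ℕ) : ℤ) * ((c : ℕ) : ℤ) ^ 3, 0⟩ : WeierstrassCurve ℤ)).c₄)
    (k : ℕ) (hk0 : 0 < k) (D : ℤ)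
    (hΔ : ((⟨0, -(((c : ℕ) : ℤ) ^ 2 + (a : ℕ) * (c : ℕ)), 0, ((a : ℕ) : ℤ) * ((c : ℕ) : ℤ) ^ 3, 0⟩ : WeierstrassCurve ℤ)).Δ = q ^ k * D)
    (hD : ¬ (q : ℤ) ∣ D)
    (p : ℕ) (hp : p.Prime)
    (hpΔ : ¬ (p : ℤ) ∣ ((⟨0, -(((c : ℕ) : ℤ) ^ 2 + (a : ℕ) * (c : ℕ)), 0, ((a : ℕ) : ℤ) * ((c : ℕ) : ℤ) ^ 3, 0⟩ : WeierstrassCurve ℤ)).Δ)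
    (ap : ℤ) (hap : Literature.NumberTheory.Automorphic.frobeniusTrace
        (⟨0, -(((c : ℕ) : ℤ) ^ 2 + (a : ℕ) * (c : ℕ)), 0, ((a : ℕ) : ℤ) * ((c : ℕ) : ℤ) ^ 3, 0⟩ : WeierstrassCurve ℤ) p = ap)
    (l : ℕ) (hside : l.Prime ∧ ¬ l ∣ 46080 ∧ ¬ q ∣ l ∧ ¬ l ∣ k ∧ p ≠ l)
    (hnr : ∀ t < l, ¬ ((l : ℤ) ∣ (t : ℤ) ^ 2 - ap * t + p)) :
    Cor22.CondP6 (ratPoint (((a : ℕ) : ℚ) / (c : ℕ))) l :=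
  condP6_ratPoint_of_certificate_list a c ha hc hac q hq hc4 k hk0 D hΔ hD p hp hpΔ ap hap [l]
    (fun l' hl' => by rw [List.mem_singleton.mp hl']; exact hside)
    (fun l' hl' => by rw [List.mem_singleton.mp hl']; exact hnr) l (List.mem_singleton.mpr rfl)

end FreyP6Engine

end Summit.ABC.IUTFork.Conditional

end
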